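import Mathlib.Analysis.SpecialFunctions.Trigonometric.Arctan
import Mathlib.Topology.Algebra.Field
import Mathlib.Topology.OpenPartialHomeomorph.Constructions
import HarnessLib

/-!
# Renormalising a sub-box of a planar chart onto the whole plane

Topic: Topology / PlanarFoliations (chart bookkeeping). The foliated atlases of
`Literature.Topology.FourManifolds.Foliation` consist of charts onto the **whole** box `B × ℝ`.
To restrict a foliation to an open subset, or to build an atlas from local homeomorphisms onto
open subsets of the plane, one renormalises a small open box around a point onto the whole
plane by a product of increasing homeomorphisms of intervals onto `ℝ`:

* `intervalChart a b h` (**definition**): the increasing homeomorphism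
  `x ↦ tan (π / (b - a) · (x - (a + b) / 2))` of `(a, b)` onto `ℝ`, as an open partial
  homeomorphism of `ℝ` with source `Ioo a b` and target `univ` (`intervalChart_source`,
  `intervalChart_target`, `strictMonoOn_intervalChart`);
* `renormBox e p r hr` (**definition**): the chart `e` followed by the renormalisation of the box
  `(p.1 - r, p.1 + r) × (p.2 - r, p.2 + r)`; its source is the `e`-preimage of the box, its
  target is the whole plane when the box lies in `e.target` (`renormBox_target`), and both
  coordinates are increasing functions of the old ones, so that equality and order of heights
  (second coordinates) are preserved (`renormBox_snd_eq_iff`, `renormBox_snd_lt_iff`,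
  `renormBox_fst_lt_iff`).

All statements are [folklore].
-/

noncomputable section

open Set Filter Function Real
open scoped Topology

namespace Literature.Topology.PlanarFoliations

/-! ## The increasing homeomorphism of an open interval onto the line -/

/-- The affine increasing homeomorphism of `ℝ` taking `(a, b)` onto `(-π/2, π/2)`. [folklore] -/
def intervalAffine (a b : ℝ) (h : a < b) : ℝ ≃ₜ ℝ :=
  affineHomeomorph (π / (b - a)) (-(π / (b - a)) * ((a + b) / 2)) (div_pos pi_pos (sub_pos.2 h)).ne'

/-- The affine map is `x ↦ π / (b - a) · (x - (a + b) / 2)`. [folklore] -/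
theorem intervalAffine_apply (a b : ℝ) (h : a < b) (x : ℝ) :
    intervalAffine a b h x = π / (b - a) * (x - (a + b) / 2) := by
  simp only [intervalAffine, affineHomeomorph]
  show π / (b - a) * x + -(π / (b - a)) * ((a + b) / 2) = π / (b - a) * (x - (a + b) / 2)
  ring

/-- The affine map takes `(a, b)` exactly onto `(-π/2, π/2)`. [folklore] -/
theorem intervalAffine_mem_Ioo_iff (a b : ℝ) (h : a < b) (x : ℝ) :
    intervalAffine a b h x ∈ Ioo (-(π / 2)) (π / 2) ↔ x ∈ Ioo a b := by
  rw [intervalAffine_apply]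
  have hba : 0 < b - a := sub_pos.2 h
  have hc : 0 < π / (b - a) := div_pos pi_pos hba
  have ha : π / (b - a) * (a - (a + b) / 2) = -(π / 2) := by field_simp; ring
  have hb : π / (b - a) * (b - (a + b) / 2) = π / 2 := by field_simp; ring
  constructor
  · rintro ⟨h1, h2⟩
    rw [← ha] at h1
    rw [← hb] at h2
    have h1' := lt_of_mul_lt_mul_left h1 hc.le
    have h2' := lt_of_mul_lt_mul_left h2 hc.le
    exact ⟨by linarith, by linarith⟩
  · rintro ⟨h1, h2⟩
    rw [← ha, ← hb]
    exact ⟨mul_lt_mul_of_pos_left (by linarith) hc, mul_lt_mul_of_pos_left (by linarith) hc⟩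

/-- The affine map is strictly increasing. [folklore] -/
theorem strictMono_intervalAffine (a b : ℝ) (h : a < b) : StrictMono (intervalAffine a b h) := by
  intro x y hxy
  rw [intervalAffine_apply, intervalAffine_apply]
  exact mul_lt_mul_of_pos_left (by linarith) (div_pos pi_pos (sub_pos.2 h))

/-- **The increasing homeomorphism of `(a, b)` onto `ℝ`**: `x ↦ tan (π / (b - a) · (x - (a + b) / 2))`,
as an open partial homeomorphism of `ℝ` with source `(a, b)` and target `ℝ`. [folklore] -/
def intervalChart (a b : ℝ) (h : a < b) : OpenPartialHomeomorph ℝ ℝ :=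
  (intervalAffine a b h).toOpenPartialHomeomorph.trans tanPartialHomeomorph

/-- The formula for `intervalChart`. [folklore] -/
theorem intervalChart_apply (a b : ℝ) (h : a < b) (x : ℝ) :
    intervalChart a b h x = Real.tan (π / (b - a) * (x - (a + b) / 2)) := by
  rw [← intervalAffine_apply]; rfl

/-- The source of `intervalChart` is the interval. [folklore] -/
@[simp] theorem intervalChart_source (a b : ℝ) (h : a < b) : (intervalChart a b h).source = Ioo a b := by
  ext x
  rw [intervalChart, OpenPartialHomeomorph.trans_source, Homeomorph.toOpenPartialHomeomorph_source, univ_inter,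
    mem_preimage]
  exact intervalAffine_mem_Ioo_iff a b h x

/-- The target of `intervalChart` is the whole line. [folklore] -/
@[simp] theorem intervalChart_target (a b : ℝ) (h : a < b) : (intervalChart a b h).target = univ := by
  rw [intervalChart, OpenPartialHomeomorph.trans_target]
  show (univ : Set ℝ) ∩ tanPartialHomeomorph.symm ⁻¹' (intervalAffine a b h).toOpenPartialHomeomorph.target = univ
  rw [Homeomorph.toOpenPartialHomeomorph_target, preimage_univ, inter_univ]

/-- **`intervalChart` is strictly increasing on the interval.** [folklore] -/
theorem strictMonoOn_intervalChart (a b : ℝ) (h : a < b) : StrictMonoOn (intervalChart a b h) (Ioo a b) := by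
  intro x hx y hy hxy
  rw [intervalChart_apply, intervalChart_apply, ← intervalAffine_apply a b h, ← intervalAffine_apply a b h]
  exact strictMonoOn_tan ((intervalAffine_mem_Ioo_iff a b h x).2 hx) ((intervalAffine_mem_Ioo_iff a b h y).2 hy)
    (strictMono_intervalAffine a b h hxy)

/-- `intervalChart` is injective on the interval. [folklore] -/
theorem injOn_intervalChart (a b : ℝ) (h : a < b) : InjOn (intervalChart a b h) (Ioo a b) :=
  (strictMonoOn_intervalChart a b h).injOn

/-- Order through `intervalChart`. [folklore] -/
theorem intervalChart_lt_iff (a b : ℝ) (h : a < b) {x y : ℝ} (hx : x ∈ Ioo a b) (hy : y ∈ Ioo a b) :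
    intervalChart a b h x < intervalChart a b h y ↔ x < y :=
  (strictMonoOn_intervalChart a b h).lt_iff_lt hx hy

/-- Equality through `intervalChart`. [folklore] -/
theorem intervalChart_eq_iff (a b : ℝ) (h : a < b) {x y : ℝ} (hx : x ∈ Ioo a b) (hy : y ∈ Ioo a b) :
    intervalChart a b h x = intervalChart a b h y ↔ x = y :=
  (injOn_intervalChart a b h).eq_iff hx hy

/-! ## Renormalising a box of a planar chart -/

section Box

variable {M : Type*} [TopologicalSpace M]

/-- The open box of half-side `r` about `p`. [folklore] -/
def box (p : ℝ × ℝ) (r : ℝ) : Set (ℝ × ℝ) := Ioo (p.1 - r) (p.1 + r) ×ˢ Ioo (p.2 - r) (p.2 + r)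

/-- Membership in the box. [folklore] -/
theorem mem_box_iff {p q : ℝ × ℝ} {r : ℝ} : q ∈ box p r ↔ q.1 ∈ Ioo (p.1 - r) (p.1 + r) ∧ q.2 ∈ Ioo (p.2 - r) (p.2 + r) :=
  mem_prod

/-- The centre belongs to its box. [folklore] -/
theorem mem_box_self (p : ℝ × ℝ) {r : ℝ} (hr : 0 < r) : p ∈ box p r :=
  ⟨⟨by linarith, by linarith⟩, ⟨by linarith, by linarith⟩⟩

/-- The box is open. [folklore] -/
theorem isOpen_box (p : ℝ × ℝ) (r : ℝ) : IsOpen (box p r) := isOpen_Ioo.prod isOpen_Ioo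

/-- The box is the metric ball (max norm). [folklore] -/
theorem box_eq_ball (p : ℝ × ℝ) (r : ℝ) : box p r = Metric.ball p r := by
  ext q
  rw [mem_box_iff, Metric.mem_ball, Prod.dist_eq, max_lt_iff, Real.dist_eq, Real.dist_eq, abs_lt, abs_lt, mem_Ioo,
    mem_Ioo]
  constructor
  · rintro ⟨⟨h1, h2⟩, ⟨h3, h4⟩⟩; exact ⟨⟨by linarith, by linarith⟩, ⟨by linarith, by linarith⟩⟩
  · rintro ⟨⟨h1, h2⟩, ⟨h3, h4⟩⟩; exact ⟨⟨by linarith, by linarith⟩, ⟨by linarith, by linarith⟩⟩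

/-- The renormalisation of the box about `p` onto the plane: a product of interval charts.
[folklore] -/
def boxChart (p : ℝ × ℝ) (r : ℝ) (hr : 0 < r) : OpenPartialHomeomorph (ℝ × ℝ) (ℝ × ℝ) :=
  (intervalChart (p.1 - r) (p.1 + r) (by linarith)).prod (intervalChart (p.2 - r) (p.2 + r) (by linarith))

/-- The source of the box chart is the box. [folklore] -/
@[simp] theorem boxChart_source (p : ℝ × ℝ) (r : ℝ) (hr : 0 < r) : (boxChart p r hr).source = box p r := by
  rw [boxChart, OpenPartialHomeomorph.prod_source, intervalChart_source, intervalChart_source]; rfl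

/-- The target of the box chart is the plane. [folklore] -/
@[simp] theorem boxChart_target (p : ℝ × ℝ) (r : ℝ) (hr : 0 < r) : (boxChart p r hr).target = univ := by
  rw [boxChart, OpenPartialHomeomorph.prod_target, intervalChart_target, intervalChart_target, univ_prod_univ]

/-- The box chart acts coordinatewise. [folklore] -/
theorem boxChart_apply (p : ℝ × ℝ) (r : ℝ) (hr : 0 < r) (q : ℝ × ℝ) :
    boxChart p r hr q = (intervalChart (p.1 - r) (p.1 + r) (by linarith) q.1,
      intervalChart (p.2 - r) (p.2 + r) (by linarith) q.2) := rfl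

/-- **Renormalising a box of a planar chart**: the chart `e` followed by the renormalisation of
the box of half-side `r` about `p` onto the whole plane. [folklore] -/
def renormBox (e : OpenPartialHomeomorph M (ℝ × ℝ)) (p : ℝ × ℝ) (r : ℝ) (hr : 0 < r) : OpenPartialHomeomorph M (ℝ × ℝ) :=
  e.trans (boxChart p r hr)

variable {e : OpenPartialHomeomorph M (ℝ × ℝ)} {p : ℝ × ℝ} {r : ℝ} {hr : 0 < r} {y z : M}

/-- The source of the renormalised chart: the `e`-preimage of the box. [folklore] -/
theorem renormBox_source (e : OpenPartialHomeomorph M (ℝ × ℝ)) (p : ℝ × ℝ) (r : ℝ) (hr : 0 < r) :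
    (renormBox e p r hr).source = e.source ∩ e ⁻¹' box p r := by
  rw [renormBox, OpenPartialHomeomorph.trans_source, boxChart_source]

/-- Membership in the source of the renormalised chart. [folklore] -/
theorem mem_renormBox_source_iff : y ∈ (renormBox e p r hr).source ↔ y ∈ e.source ∧ e y ∈ box p r := by
  rw [renormBox_source]; rfl

/-- The source of the renormalised chart lies in the source of `e`. [folklore] -/
theorem renormBox_source_subset (e : OpenPartialHomeomorph M (ℝ × ℝ)) (p : ℝ × ℝ) (r : ℝ) (hr : 0 < r) :
    (renormBox e p r hr).source ⊆ e.source := by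
  rw [renormBox_source]; exact inter_subset_left

/-- **The target of the renormalised chart is the whole plane** when the box lies in the target
of `e`. [folklore] -/
theorem renormBox_target (hbox : box p r ⊆ e.target) : (renormBox e p r hr).target = univ := by
  rw [renormBox, OpenPartialHomeomorph.trans_target, boxChart_target, univ_inter, eq_univ_iff_forall]
  intro w
  rw [mem_preimage]
  apply hbox
  have := (boxChart p r hr).map_target (x := w) (by rw [boxChart_target]; exact mem_univ _)
  rwa [boxChart_source] at this

/-- The renormalised chart acts by `e` followed by the interval charts coordinatewise.
[folklore] -/
theorem renormBox_apply (y : M) :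
    renormBox e p r hr y = (intervalChart (p.1 - r) (p.1 + r) (by linarith) (e y).1,
      intervalChart (p.2 - r) (p.2 + r) (by linarith) (e y).2) := rfl

/-- A point of `e.source` read in the box lies in the source of the renormalised chart.
[folklore] -/
theorem mem_renormBox_source (hy : y ∈ e.source) (hbox : e y ∈ box p r) : y ∈ (renormBox e p r hr).source :=
  mem_renormBox_source_iff.2 ⟨hy, hbox⟩

/-- The centre point: `y ∈ e.source` lies in the source of the renormalisation of the box about
`e y`. [folklore] -/
theorem mem_renormBox_source_self (hy : y ∈ e.source) (hr : 0 < r) : y ∈ (renormBox e (e y) r hr).source :=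
  mem_renormBox_source hy (mem_box_self _ hr)

/-- **Heights are compared through an increasing map**: equality of the second coordinates is
preserved. [folklore] -/
theorem renormBox_snd_eq_iff (hy : y ∈ (renormBox e p r hr).source) (hz : z ∈ (renormBox e p r hr).source) :
    (renormBox e p r hr y).2 = (renormBox e p r hr z).2 ↔ (e y).2 = (e z).2 := by
  rw [renormBox_apply, renormBox_apply]
  exact intervalChart_eq_iff _ _ _ (mem_renormBox_source_iff.1 hy).2.2 (mem_renormBox_source_iff.1 hz).2.2

/-- Order of the second coordinates is preserved. [folklore] -/
theorem renormBox_snd_lt_iff (hy : y ∈ (renormBox e p r hr).source) (hz : z ∈ (renormBox e p r hr).source) :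
    (renormBox e p r hr y).2 < (renormBox e p r hr z).2 ↔ (e y).2 < (e z).2 := by
  rw [renormBox_apply, renormBox_apply]
  exact intervalChart_lt_iff _ _ _ (mem_renormBox_source_iff.1 hy).2.2 (mem_renormBox_source_iff.1 hz).2.2

/-- Order of the first coordinates is preserved. [folklore] -/
theorem renormBox_fst_lt_iff (hy : y ∈ (renormBox e p r hr).source) (hz : z ∈ (renormBox e p r hr).source) :
    (renormBox e p r hr y).1 < (renormBox e p r hr z).1 ↔ (e y).1 < (e z).1 := by
  rw [renormBox_apply, renormBox_apply]
  exact intervalChart_lt_iff _ _ _ (mem_renormBox_source_iff.1 hy).2.1 (mem_renormBox_source_iff.1 hz).2.1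

/-- Equality of the first coordinates is preserved. [folklore] -/
theorem renormBox_fst_eq_iff (hy : y ∈ (renormBox e p r hr).source) (hz : z ∈ (renormBox e p r hr).source) :
    (renormBox e p r hr y).1 = (renormBox e p r hr z).1 ↔ (e y).1 = (e z).1 := by
  rw [renormBox_apply, renormBox_apply]
  exact intervalChart_eq_iff _ _ _ (mem_renormBox_source_iff.1 hy).2.1 (mem_renormBox_source_iff.1 hz).2.1

/-- **Small boxes**: for `y ∈ e.source` and any neighbourhood `U` of `y`, the renormalisation of
a small enough box about `e y` has its source inside `U`. [folklore] -/
theorem exists_renormBox_source_subset (hy : y ∈ e.source) {U : Set M} (hU : U ∈ 𝓝 y) :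
    ∃ r > 0, ∀ hr : 0 < r, (renormBox e (e y) r hr).source ⊆ U := by
  -- `e.symm` is continuous at `e y` with value `y`; pull `U` back to a neighbourhood of `e y`
  have hcont : ContinuousAt e.symm (e y) := e.continuousAt_symm (e.map_source hy)
  have hU' : e.symm ⁻¹' U ∈ 𝓝 (e y) := hcont.preimage_mem_nhds (by rwa [e.left_inv hy])
  have htgt : e.target ∈ 𝓝 (e y) := e.open_target.mem_nhds (e.map_source hy)
  obtain ⟨ε, hε, hball⟩ := Metric.mem_nhds_iff.1 (inter_mem hU' htgt)
  refine ⟨ε, hε, fun hr w hw ↦ ?_⟩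
  obtain ⟨hwe, hwbox⟩ := mem_renormBox_source_iff.1 hw
  rw [box_eq_ball] at hwbox
  have := (hball hwbox).1
  rw [mem_preimage, e.left_inv hwe] at this
  exact this

/-- For `y ∈ e.source`, small boxes about `e y` lie in `e.target`. [folklore] -/
theorem exists_box_subset_target (hy : y ∈ e.source) : ∃ r > 0, box (e y) r ⊆ e.target := by
  obtain ⟨ε, hε, hball⟩ := Metric.mem_nhds_iff.1 (e.open_target.mem_nhds (e.map_source hy))
  exact ⟨ε, hε, by rw [box_eq_ball]; exact hball⟩

end Box

end Literature.Topology.PlanarFoliations
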